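import Summits.BirchSwinnertonDyer.BirchSwinnertonDyer.Theorems.ByReductionTypeAtTwoRankOneAtTwoOneDoorLawDefs
import Literature.NumberTheory.EllipticCurves.HeegnerPointsOfConductor
import Literature.NumberTheory.EllipticCurves.Milne1972.WeilRestrictionQuadraticBSDQuotientAnyModel
import HarnessLib

/-!
# Route `ByReductionTypeAtTwo`, crux `RankOneAtTwoOffBigImageOddLocal` (stmt-BirchSwinnertonDyer-23716), line
# `refined_kolyvagin_tamagawa_shift_at_two`: the line's STATEMENTS as closed, named, importable declarations

Lead prover `prover-cruxlead-stmt-BirchSwinnertonDyer-23716-g0` (2026-08-28; pattern of the sibling crux's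
`…RankOneAtTwoOneDoorLawDefs.lean`).  The registered skeleton `Cruxes/RankOneAtTwoOffBigImageOddLocal/Lines/refined_kolyvagin_tamagawa_shift_at_two.lean`
(g6; 7 stubs registered on the item) reduces the crux «`BSD(W, 2)` for every globally minimal non-CM `W/ℚ` of analytic rank `1` OFF the slice
{`ρ_{W,2^∞}` onto ∧ odd `#E(ℚ)_tors` ∧ odd `∏ c_ℓ`}» to: the published inputs and the route's four rank-`0` cruxes by name, the two γ₁ DOOR faces
(`Gamma1OddCDoorIndexLawAtTwo`, `Gamma1EvenCDoorIndexLawAtTwo`; E-side, image `C₃`), the three S₃-locus KOLYVAGIN statements at `p = 2` with the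
Tamagawa shift `σ := v₂ ∏_ℓ c_ℓ(W) + v₂ c(Dt)` (`SigmaAccumulationModTwoAtTwo`, `StringentPrimitivityModTwoAtTwo` — load-bearing —,
`ShiftedKolyvaginStructureModTwoAtTwo`), and the β residual `TwoTorsionHalf` (the `E(ℚ)[2] ≠ 0` half, owned by the crux's other two lines).  Until now
these statements existed only inside the `Cruxes/` workfile (not importable from `Theorems/`).  Here they are stated VERBATIM (the registered g2–g6
bodies, character for character, `sigmaShift` included) as closed declarations in ONE importable, route-independent module (no `Theses` import; the
by-name conjunction of the route's four rank-`0` items, `S_rankZero4`, therefore stays in the skeleton), so that (i) stub workers / delegated seats and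
the crux's disprover can target the registered statements BY NAME, (ii) the skeleton's cell glue can land as `Theorems/` files over these names, and
(iii) the skeleton's stubs become one-line citations.  Also recorded: the cell predicates of the line's atlas (γ₂a/b/c/d, δ±, `OffGamma2c`), the two
witness filters (`RegularAtTwo`, `SharpAtTwo`), the cell-indexed K2/K3 statements `…WithOn Φ Ω`, and the E-side chart socket `EChartAtTwo Ω`.

Every body is a statement over tree symbols (`ModularParametrizationData`, `KolyvaginHeegnerData`, `derivedPoint`, `Zhang2014.IsKolyvaginPrime`,
`Zhang2014.levelIndex`, `ringClassField`, `DoorAdmissible`, `transpCount`, `identCount`, `HasTwoDivisibilityUpToTorsion`, `heegnerPointComplex`,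
`HeegnerDatum`, `NoRationalTwoTorsion`, `sha`, `tamagawaProduct`, `analyticRank`, `entireLFunction`, `BSDp`, `S_pub`, `S_pubHL`, `S_rankZeroTwin`).
These are the LINE'S STUB SIGNATURES and cell vocabulary (to be proved / refuted / reshaped here), not published facts: nothing is asserted, no
cite-tagged closed `Prop` (locators are plain text, so that the gate does not relocate a stub signature to `Literature/`).  BSD is not proved by any of this; the crux is not proved; five of the statements are open
mathematics at `p = 2` (nothing in print: W. Zhang 2014 `p ≥ 5`; Burungale–Castella–Grossi–Skinner 2023 Thm. 2 — the refined Kolyvagin conjecture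
`M_∞ = Σ_ℓ ord_p c_ℓ`, exactly the `σ`-shift — `p > 3`; Kriz–Li 2019 only `M₀ = σ = 0`).

References (locators): Jetchev 2008 (1.3), Thm. 1.4; W. Zhang, Camb. J. Math. 2 (2014) §3.7, Notations (xii); Burungale–Castella–Grossi–Skinner,
arXiv:2312.09301 Thm. 2; McCallum, LMS LNS 153 (1991) §5; Gross, ibid. §§3–4; Dokchitser–Dokchitser, Math. Z. (2012); Rouse–Zureick-Brown (2015).
-/

set_option linter.dupNamespace false -- tree convention: `Summit.BirchSwinnertonDyer.BirchSwinnertonDyer.Theorems` (summit = sub-problem)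
set_option autoImplicit false

noncomputable section

open scoped Classical

namespace Summit.BirchSwinnertonDyer.BirchSwinnertonDyer.Theorems.OffBigImageOddLocalAtTwo

open WeierstrassCurve NumberField IsDedekindDomain Rat.HeightOneSpectrum Literature.NumberTheory.EllipticCurves
  Literature.NumberTheory.EllipticCurves.ModularForms
  Summit.BirchSwinnertonDyer.Rank1Residual.F1Sign2
  Summit.BirchSwinnertonDyer.Rank1Residual.F1Sign2.TranspositionDoor
  Summit.BirchSwinnertonDyer.BirchSwinnertonDyer.Theorems.RankOneAtTwoOneDoor

/-- **The shift `σ(W, Dt) := v₂ ∏_ℓ c_ℓ(W) + v₂ c(Dt)`** — the Tamagawa SUM (`v₂` of the product = `Σ_ℓ v₂ c_ℓ`) plus the `2`-adic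
valuation of the constant of the parametrisation datum in use.  BSD + Gross–Zagier predict `𝓜_∞ = σ` for Kolyvagin's divisibility
index of the derived Heegner points of `Dt` (Jetchev 2008 (1.3), `m_∞ = ord_p(c·∏ c_q)`), for EVERY datum (a datum with `φ = k·φ₁`
has constant `k c₁` and derived points `k·P₁(n)`, so both sides move by `v₂ k`). -/
def sigmaShift (W : WeierstrassCurve ℚ) [W.IsElliptic] [W.IsGloballyMinimal] [NeZero (W.conductorNorm ℤ)]
    (Dt : ModularParametrizationData W (W.conductorNorm ℤ)) : ℕ :=
  padicValNat 2 W.tamagawaProduct + padicValInt 2 Dt.c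

/-- S1 PRINT: the published inputs the line consumes, BY NAME (tree named facts, statements only): `S_pub` (Gross–Zagier 1986
Thm. I.6.3, Kolyvagin 1990 Thm. A, Heegner rationality — a tree theorem —, GZK over `ℚ`, modularity `hasEntireLFunction_rat`),
`S_pubHL` (modularity as a newform BCDT 2001 Thm. A, Hoffstein–Luo 1997), Milne 1972 §1 Thm. 1 (BSD quotient of a quadratic base
change, any model). -/
def S_print : Prop :=
  S_pub ∧ S_pubHL ∧ Milne1972.bsdQuotient_baseChange_quadratic_anyModel

/-- S7 RESIDUAL — the `E(ℚ)[2] ≠ 0` half of the crux (stratum β; habitat of the cards `go-borel-gl1-transport-at-two` and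
`eisenstein-kummer-genus-at-two`, NOT of this line).  Declared residual on the line card. -/
def TwoTorsionHalf : Prop :=
  ∀ (W : WeierstrassCurve ℚ) [W.IsElliptic] [W.IsGloballyMinimal], ¬ W.HasCM → ¬ NoRationalTwoTorsion W →
    W.analyticRank = 1 → BSDp W 2

/-- **The RZB / Dokchitser–Dokchitser list at `2` for curves without rational `2`-torsion** — the five families off the surjective
`2`-adic locus: `Δ ∈ ℚ^{×2}` (γ₁: mod-`2` image `C₃`) ∨ `−Δ ∈ ℚ^{×2}` (γ₂a) ∨ `j = −4t³(t+8)` (γ₂b, the `X_ns⁺(4)` family) ∨ `2Δ ∈ ℚ^{×2}` (γ₂c)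
∨ `−2Δ ∈ ℚ^{×2}` (γ₂d).  On {`E(ℚ)[2] = 0`} this is equivalent to «`ρ_{W,2^∞}` not onto» (tree theorem
`not_forall_hasSurjectiveModNGaloisRep_two_pow_iff`). (DokchitserDokchitserMathZ2012, Theorem (1)–(3)) (RouseZureickbrown2015, §1) -/
def InRZBListAtTwo (W : WeierstrassCurve ℚ) [W.IsElliptic] : Prop :=
  IsSquare W.Δ ∨ IsSquare (-W.Δ) ∨ (∃ t : ℚ, W.j = -4 * t ^ 3 * (t + 8)) ∨ IsSquare (2 * W.Δ) ∨ IsSquare (-2 * W.Δ)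

/-- **S2a′ `Gamma1OddCDoorIndexLawAtTwo` — the γ₁ door index law on ODD `∏c` (registered stub of line 1).**  For `W` globally minimal,
non-CM, with `E(ℚ)[2] = 0`, `Δ ∈ ℚ^{×2}` (mod-`2` image `C₃`), odd `∏ c_ℓ(W)` and analytic rank `1`; for every imaginary quadratic `K` with
door-admissible `d_K`, the Heegner hypothesis for `N_E` and `L(E^{(d_K)},1) ≠ 0`; for ANY parametrisation datum `Dt`, Heegner datum `H`, embedding
`ι` and `P ∈ E(K)` mapping to the complex Heegner point; for any globally minimal model `Wd` of the twist: the exact `2`-divisibility exponent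
`m` of `P` modulo torsion exists and `2m + [Δ<0] = s_W + s_d + t + 2·s + 2·v₂ c(Dt)` (`s_W = ord₂ #Ш(W)[2^∞]`, `s_d = ord₂ #Ш(Wd)[2^∞]`,
`t`/`s` = door primes of transposition/identity type).  BSD₂-EQUIVALENT per curve (`OffBigImageOddLocalAtTwo.bsdp_two_iff_doorLawFullCT_at`,
odd `∏c` killing the Tamagawa term).  OPEN. -/
def Gamma1OddCDoorIndexLawAtTwo : Prop :=
  ∀ (W : WeierstrassCurve ℚ) [W.IsElliptic] [W.IsGloballyMinimal] [NeZero (W.conductorNorm ℤ)],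
    ¬ W.HasCM → NoRationalTwoTorsion W → IsSquare W.Δ → Odd W.tamagawaProduct → W.analyticRank = 1 →
    ∀ (K : Type) [Field K] [NumberField K], IsImaginaryQuadratic K →
      DoorAdmissible W (NumberField.discr K) → SatisfiesHeegnerHypothesis (W.conductorNorm ℤ) K →
      (W.quadraticTwist (NumberField.discr K : ℚ)).entireLFunction 1 ≠ 0 →
      ∀ (Dt : ModularParametrizationData W (W.conductorNorm ℤ))
        (H : HeegnerDatum (W.conductorNorm ℤ) (NumberField.discr K)) (ι : K →+* ℂ)
        (P : (W.baseChange K).toAffine.Point),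
        WeierstrassCurve.Affine.Point.map ι.toRatAlgHom P = heegnerPointComplex Dt H →
        ∀ (Wd : WeierstrassCurve ℚ) [Wd.IsElliptic] [Wd.IsGloballyMinimal] (Cd : WeierstrassCurve.VariableChange ℚ),
          Cd • W.quadraticTwist (NumberField.discr K : ℚ) = Wd →
          ∃ m : ℕ, HasTwoDivisibilityUpToTorsion W K P m ∧
            2 * m + (if W.Δ < 0 then 1 else 0) =
              padicValNat 2 (Nat.card (AddCommGroup.primaryComponent W.sha 2)) +
                padicValNat 2 (Nat.card (AddCommGroup.primaryComponent Wd.sha 2)) +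
                transpCount W (NumberField.discr K) + 2 * identCount W (NumberField.discr K) +
                2 * padicValInt 2 Dt.c

/-- **S2b′ `Gamma1EvenCDoorIndexLawAtTwo` — the γ₁ door index law on EVEN `∏c` (registered stub of line 1):** the same law on
{`E(ℚ)[2] = 0`, `Δ ∈ ℚ^{×2}`, `∏ c_ℓ(W)` even} with the Tamagawa valuation carried, `… + 2·v₂ c(Dt) + 2·v₂ ∏ c_ℓ(W)`.  BSD₂-equivalent per
curve by the same iff; no instrument on file (the least-instrumented cell of the line).  OPEN. -/
def Gamma1EvenCDoorIndexLawAtTwo : Prop :=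
  ∀ (W : WeierstrassCurve ℚ) [W.IsElliptic] [W.IsGloballyMinimal] [NeZero (W.conductorNorm ℤ)],
    ¬ W.HasCM → NoRationalTwoTorsion W → IsSquare W.Δ → Even W.tamagawaProduct → W.analyticRank = 1 →
    ∀ (K : Type) [Field K] [NumberField K], IsImaginaryQuadratic K →
      DoorAdmissible W (NumberField.discr K) → SatisfiesHeegnerHypothesis (W.conductorNorm ℤ) K →
      (W.quadraticTwist (NumberField.discr K : ℚ)).entireLFunction 1 ≠ 0 →
      ∀ (Dt : ModularParametrizationData W (W.conductorNorm ℤ))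
        (H : HeegnerDatum (W.conductorNorm ℤ) (NumberField.discr K)) (ι : K →+* ℂ)
        (P : (W.baseChange K).toAffine.Point),
        WeierstrassCurve.Affine.Point.map ι.toRatAlgHom P = heegnerPointComplex Dt H →
        ∀ (Wd : WeierstrassCurve ℚ) [Wd.IsElliptic] [Wd.IsGloballyMinimal] (Cd : WeierstrassCurve.VariableChange ℚ),
          Cd • W.quadraticTwist (NumberField.discr K : ℚ) = Wd →
          ∃ m : ℕ, HasTwoDivisibilityUpToTorsion W K P m ∧
            2 * m + (if W.Δ < 0 then 1 else 0) =
              padicValNat 2 (Nat.card (AddCommGroup.primaryComponent W.sha 2)) +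
                padicValNat 2 (Nat.card (AddCommGroup.primaryComponent Wd.sha 2)) +
                transpCount W (NumberField.discr K) + 2 * identCount W (NumberField.discr K) +
                2 * padicValInt 2 Dt.c + 2 * padicValNat 2 W.tamagawaProduct

/-- **The CT door law FOR ONE CURVE** (the inner quantifier block of the γ statements, Tamagawa valuation carried, any parity): for every
admissible door `K`, every datum `Dt`/`H`/`ι`, every `K`-rational Heegner point `P` and every globally minimal twist model `Wd`, the exact
`2`-divisibility exponent `m` of `P` modulo torsion exists and `2m + [Δ<0] = s_W + s_d + t + 2s + 2·v₂ c(Dt) + 2·v₂ ∏ c_ℓ(W)`.  Equivalent to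
`BSD(W, 2)` for `W` of analytic rank `1` with `E(ℚ)[2] = 0` given the published inputs and rank-`0` `BSD₂` of the twin
(`bsdp_two_iff_doorLawFullCT_at`). -/
def DoorLawCTFor (W : WeierstrassCurve ℚ) [W.IsElliptic] [W.IsGloballyMinimal] [NeZero (W.conductorNorm ℤ)] : Prop :=
  ∀ (K : Type) [Field K] [NumberField K], IsImaginaryQuadratic K →
    DoorAdmissible W (NumberField.discr K) → SatisfiesHeegnerHypothesis (W.conductorNorm ℤ) K →
    (W.quadraticTwist (NumberField.discr K : ℚ)).entireLFunction 1 ≠ 0 →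
    ∀ (Dt : ModularParametrizationData W (W.conductorNorm ℤ))
      (H : HeegnerDatum (W.conductorNorm ℤ) (NumberField.discr K)) (ι : K →+* ℂ)
      (P : (W.baseChange K).toAffine.Point),
      WeierstrassCurve.Affine.Point.map ι.toRatAlgHom P = heegnerPointComplex Dt H →
      ∀ (Wd : WeierstrassCurve ℚ) [Wd.IsElliptic] [Wd.IsGloballyMinimal] (Cd : WeierstrassCurve.VariableChange ℚ),
        Cd • W.quadraticTwist (NumberField.discr K : ℚ) = Wd →
        ∃ m : ℕ, HasTwoDivisibilityUpToTorsion W K P m ∧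
          2 * m + (if W.Δ < 0 then 1 else 0) =
            padicValNat 2 (Nat.card (AddCommGroup.primaryComponent W.sha 2)) +
              padicValNat 2 (Nat.card (AddCommGroup.primaryComponent Wd.sha 2)) +
              transpCount W (NumberField.discr K) + 2 * identCount W (NumberField.discr K) +
              2 * padicValInt 2 Dt.c + 2 * padicValNat 2 W.tamagawaProduct

/-- The two γ₁ faces recombined (g0's single γ statement restricted to γ₁, per curve): what the γ₁ glue `bsdp_two_gamma1` consumes.  Not a stub. -/
def Gamma1DoorIndexLawCTAtTwo : Prop :=
  ∀ (W : WeierstrassCurve ℚ) [W.IsElliptic] [W.IsGloballyMinimal] [NeZero (W.conductorNorm ℤ)],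
    ¬ W.HasCM → NoRationalTwoTorsion W → IsSquare W.Δ → W.analyticRank = 1 → DoorLawCTFor W

/-- **S3′ `SigmaAccumulationModTwoAtTwo` (K1 on the S₃-locus, the `≥` half: Σ-ACCUMULATION; registered stub of line 1).**  For `W` globally
minimal, non-CM, with `ρ̄_{W,2}` onto and analytic rank `1`; `K` imaginary quadratic, Kolyvagin-admissible at `2` (odd `d_K ≠ −3`, Heegner
hypothesis, `d_K·(−|Δ|)` and `d_K·(−2|Δ|)` non-squares — Kolyvagin's Theorem-B₂ exclusions); ANY datum `Dt`, orientation `β`, embedding `ι`; every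
square-free product `n` of Kolyvagin primes at `2` (`n = 1` included, `M(1) = ∞`) and every conductor-`n` Kolyvagin datum `d`: the derived point
`P(n)` is `2^m`-divisible in `E(K[n])` for every `m ≤ min(σ(W, Dt), M(n))`.  Jetchev's `m(n) ≥ m_∞` with the refined value `m_∞ = σ` (Jetchev 2008
Thm. 1.4 / BCGS 2023 Thm. 2 at odd `p`); OPEN at `p = 2`. (WZhang2014, §3.7) -/
def SigmaAccumulationModTwoAtTwo : Prop :=
  ∀ (W : WeierstrassCurve ℚ) [W.IsElliptic] [W.IsGloballyMinimal] [NeZero (W.conductorNorm ℤ)],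
    ¬ W.HasCM → W.HasSurjectiveModNGaloisRep 2 → W.analyticRank = 1 →
    ∀ (K : Type) [Field K] [NumberField K], IsImaginaryQuadratic K → Odd (NumberField.discr K) →
      NumberField.discr K ≠ -3 → SatisfiesHeegnerHypothesis (W.conductorNorm ℤ) K →
      ¬ IsSquare ((NumberField.discr K : ℚ) * -|W.Δ|) → ¬ IsSquare ((NumberField.discr K : ℚ) * (-(2 * |W.Δ|))) →
      ∀ (Dt : ModularParametrizationData W (W.conductorNorm ℤ)) (β : ℤ) (ι : K →+* ℂ)
        (n : ℕ) (d : KolyvaginHeegnerData Dt β ι n) (m : ℕ),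
        Squarefree n → (∀ ℓ ∈ n.primeFactors, Zhang2014.IsKolyvaginPrime (W.conductorNorm ℤ) W K 2 ℓ) →
        (m : ℕ∞) ≤ Zhang2014.levelIndex W 2 n → m ≤ sigmaShift W Dt →
        ∃ Q : (W.baseChange (ringClassField K ι n)).toAffine.Point, ((2 ^ m : ℕ) : ℤ) • Q = d.derivedPoint

/-- **S4′(Φ) `StringentPrimitivityModTwoWith Φ` (K2 on the S₃-locus with a WITNESS FILTER `Φ`, the `≤` half: STRINGENT PRIMITIVITY =
Kolyvagin's conjecture at `2` at level `σ + 1`).**  Same habitat as S3′; for ANY `Dt`, `β`, `ι` and conductor-`1` datum `d₁` with `y_K = P(1)` of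
infinite order: SOME square-free product `n` of Kolyvagin primes at `2`, each satisfying `Φ W ℓ`, with `M(n) ≥ σ + 1`, carries a conductor-`n` datum
whose derived point `P(n)` is NOT `2^{σ+1}`-divisible in `E(K[n])`.  `Φ = ⊤` is the registered stub `StringentPrimitivityModTwoAtTwo`; for a
LEVEL-BOUNDED filter this cell-free form is FALSE (γ₂c wall × datum scaling) — use the cell form `StringentPrimitivityModTwoWithOn Φ Ω`. -/
def StringentPrimitivityModTwoWith (Φ : WeierstrassCurve ℚ → ℕ → Prop) : Prop :=
  ∀ (W : WeierstrassCurve ℚ) [W.IsElliptic] [W.IsGloballyMinimal] [NeZero (W.conductorNorm ℤ)],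
    ¬ W.HasCM → W.HasSurjectiveModNGaloisRep 2 → W.analyticRank = 1 →
    ∀ (K : Type) [Field K] [NumberField K], IsImaginaryQuadratic K → Odd (NumberField.discr K) →
      NumberField.discr K ≠ -3 → SatisfiesHeegnerHypothesis (W.conductorNorm ℤ) K →
      ¬ IsSquare ((NumberField.discr K : ℚ) * -|W.Δ|) → ¬ IsSquare ((NumberField.discr K : ℚ) * (-(2 * |W.Δ|))) →
      ∀ (Dt : ModularParametrizationData W (W.conductorNorm ℤ)) (β : ℤ) (ι : K →+* ℂ) (d₁ : KolyvaginHeegnerData Dt β ι 1),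
        ¬ IsOfFinAddOrder d₁.derivedPoint →
        ∃ (n : ℕ) (d : KolyvaginHeegnerData Dt β ι n), Squarefree n ∧
          (∀ ℓ ∈ n.primeFactors, Zhang2014.IsKolyvaginPrime (W.conductorNorm ℤ) W K 2 ℓ ∧ Φ W ℓ) ∧
          ((sigmaShift W Dt + 1 : ℕ) : ℕ∞) ≤ Zhang2014.levelIndex W 2 n ∧
          ¬ ∃ Q : (W.baseChange (ringClassField K ι n)).toAffine.Point,
            ((2 ^ (sigmaShift W Dt + 1) : ℕ) : ℤ) • Q = d.derivedPoint

/-- **S5′(Φ) `ShiftedKolyvaginStructureModTwoWith Φ` (K3 on the S₃-locus with a witness filter: the STRUCTURE THEOREM at `2` with the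
shift).**  Same habitat (no analytic-rank binder); `d₁` with `y_K = P(1)` of infinite order and `2^{M₀} ∥ P(1)` in `E(K[1])`; IF every derived point
is `2^{min(σ, M(n))}`-divisible (shape of K1) AND some `P(n)` at a level `M(n) ≥ σ + 1` made of `Φ`-primes is not `2^{σ+1}`-divisible (shape of
K2(Φ)), THEN `#Ш(E/K)[2^∞] = 2^{2(M₀ − σ)}` — McCallum's structure theorem `#Ш[p^∞] = p^{2(m₀ − m_∞)}` read at `p = 2` with `m_∞ = σ`.
(McCallumLMS1991, §5) -/
def ShiftedKolyvaginStructureModTwoWith (Φ : WeierstrassCurve ℚ → ℕ → Prop) : Prop :=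
  ∀ (W : WeierstrassCurve ℚ) [W.IsElliptic] [W.IsGloballyMinimal] [NeZero (W.conductorNorm ℤ)],
    ¬ W.HasCM → W.HasSurjectiveModNGaloisRep 2 →
    ∀ (K : Type) [Field K] [NumberField K], IsImaginaryQuadratic K → Odd (NumberField.discr K) →
      NumberField.discr K ≠ -3 → SatisfiesHeegnerHypothesis (W.conductorNorm ℤ) K →
      ¬ IsSquare ((NumberField.discr K : ℚ) * -|W.Δ|) → ¬ IsSquare ((NumberField.discr K : ℚ) * (-(2 * |W.Δ|))) →
      ∀ (Dt : ModularParametrizationData W (W.conductorNorm ℤ)) (β : ℤ) (ι : K →+* ℂ) (d₁ : KolyvaginHeegnerData Dt β ι 1),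
        ¬ IsOfFinAddOrder d₁.derivedPoint →
        ∀ (M₀ : ℕ), (∃ Q : (W.baseChange (ringClassField K ι 1)).toAffine.Point, ((2 ^ M₀ : ℕ) : ℤ) • Q = d₁.derivedPoint) →
          (¬ ∃ Q : (W.baseChange (ringClassField K ι 1)).toAffine.Point, ((2 ^ (M₀ + 1) : ℕ) : ℤ) • Q = d₁.derivedPoint) →
          (∀ (n : ℕ) (d : KolyvaginHeegnerData Dt β ι n) (m : ℕ), Squarefree n →
              (∀ ℓ ∈ n.primeFactors, Zhang2014.IsKolyvaginPrime (W.conductorNorm ℤ) W K 2 ℓ) →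
              (m : ℕ∞) ≤ Zhang2014.levelIndex W 2 n → m ≤ sigmaShift W Dt →
              ∃ Q : (W.baseChange (ringClassField K ι n)).toAffine.Point, ((2 ^ m : ℕ) : ℤ) • Q = d.derivedPoint) →
          ∀ (n : ℕ) (d : KolyvaginHeegnerData Dt β ι n), Squarefree n →
            (∀ ℓ ∈ n.primeFactors, Zhang2014.IsKolyvaginPrime (W.conductorNorm ℤ) W K 2 ℓ ∧ Φ W ℓ) →
            ((sigmaShift W Dt + 1 : ℕ) : ℕ∞) ≤ Zhang2014.levelIndex W 2 n →
            (¬ ∃ Q : (W.baseChange (ringClassField K ι n)).toAffine.Point,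
              ((2 ^ (sigmaShift W Dt + 1) : ℕ) : ℤ) • Q = d.derivedPoint) →
            Nat.card (AddCommGroup.primaryComponent (W.baseChange K).sha 2) = 2 ^ (2 * (M₀ - sigmaShift W Dt))

/-- **S4′ `StringentPrimitivityModTwoAtTwo` (K2 on the S₃-locus, unfiltered: the REGISTERED stub of line 1; LOAD-BEARING, hardest):**
Kolyvagin's conjecture at `p = 2` at the stringent level `σ + 1` with numerical Kolyvagin primes — SOME square-free product `n` of Kolyvagin
primes at `2` with `M(n) ≥ σ + 1` carries a derived point `P(n)` NOT `2^{σ+1}`-divisible in `E(K[n])`.  Equals `StringentPrimitivityModTwoWith ⊤`.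
OPEN (nothing in print at `2`: W. Zhang 2014 `p ≥ 5`, BCGS 2023 `p > 3`, Kriz–Li 2019 only `M₀ = σ = 0`). (WZhang2014, §3.7) -/
def StringentPrimitivityModTwoAtTwo : Prop :=
  ∀ (W : WeierstrassCurve ℚ) [W.IsElliptic] [W.IsGloballyMinimal] [NeZero (W.conductorNorm ℤ)],
    ¬ W.HasCM → W.HasSurjectiveModNGaloisRep 2 → W.analyticRank = 1 →
    ∀ (K : Type) [Field K] [NumberField K], IsImaginaryQuadratic K → Odd (NumberField.discr K) →
      NumberField.discr K ≠ -3 → SatisfiesHeegnerHypothesis (W.conductorNorm ℤ) K →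
      ¬ IsSquare ((NumberField.discr K : ℚ) * -|W.Δ|) → ¬ IsSquare ((NumberField.discr K : ℚ) * (-(2 * |W.Δ|))) →
      ∀ (Dt : ModularParametrizationData W (W.conductorNorm ℤ)) (β : ℤ) (ι : K →+* ℂ) (d₁ : KolyvaginHeegnerData Dt β ι 1),
        ¬ IsOfFinAddOrder d₁.derivedPoint →
        ∃ (n : ℕ) (d : KolyvaginHeegnerData Dt β ι n), Squarefree n ∧
          (∀ ℓ ∈ n.primeFactors, Zhang2014.IsKolyvaginPrime (W.conductorNorm ℤ) W K 2 ℓ) ∧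
          ((sigmaShift W Dt + 1 : ℕ) : ℕ∞) ≤ Zhang2014.levelIndex W 2 n ∧
          ¬ ∃ Q : (W.baseChange (ringClassField K ι n)).toAffine.Point,
            ((2 ^ (sigmaShift W Dt + 1) : ℕ) : ℤ) • Q = d.derivedPoint

/-- **S5′ `ShiftedKolyvaginStructureModTwoAtTwo` (K3 on the S₃-locus, unfiltered: the REGISTERED stub of line 1; XL):** the shifted
structure theorem at `2` — K1-shape ∧ K2-shape ⟹ `#Ш(E/K)[2^∞] = 2^{2(M₀ − σ)}`.  Gives `ShiftedKolyvaginStructureModTwoWith Φ` for every `Φ`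
(a finer filter is WEAKER here).  At `σ = 0` on δ it is route `GenusKolyvaginAtTwo`'s crux `KolyvaginExactAtTwo`.  OPEN at `p = 2`.
(McCallumLMS1991, §5) -/
def ShiftedKolyvaginStructureModTwoAtTwo : Prop :=
  ∀ (W : WeierstrassCurve ℚ) [W.IsElliptic] [W.IsGloballyMinimal] [NeZero (W.conductorNorm ℤ)],
    ¬ W.HasCM → W.HasSurjectiveModNGaloisRep 2 →
    ∀ (K : Type) [Field K] [NumberField K], IsImaginaryQuadratic K → Odd (NumberField.discr K) →
      NumberField.discr K ≠ -3 → SatisfiesHeegnerHypothesis (W.conductorNorm ℤ) K →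
      ¬ IsSquare ((NumberField.discr K : ℚ) * -|W.Δ|) → ¬ IsSquare ((NumberField.discr K : ℚ) * (-(2 * |W.Δ|))) →
      ∀ (Dt : ModularParametrizationData W (W.conductorNorm ℤ)) (β : ℤ) (ι : K →+* ℂ) (d₁ : KolyvaginHeegnerData Dt β ι 1),
        ¬ IsOfFinAddOrder d₁.derivedPoint →
        ∀ (M₀ : ℕ), (∃ Q : (W.baseChange (ringClassField K ι 1)).toAffine.Point, ((2 ^ M₀ : ℕ) : ℤ) • Q = d₁.derivedPoint) →
          (¬ ∃ Q : (W.baseChange (ringClassField K ι 1)).toAffine.Point, ((2 ^ (M₀ + 1) : ℕ) : ℤ) • Q = d₁.derivedPoint) →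
          (∀ (n : ℕ) (d : KolyvaginHeegnerData Dt β ι n) (m : ℕ), Squarefree n →
              (∀ ℓ ∈ n.primeFactors, Zhang2014.IsKolyvaginPrime (W.conductorNorm ℤ) W K 2 ℓ) →
              (m : ℕ∞) ≤ Zhang2014.levelIndex W 2 n → m ≤ sigmaShift W Dt →
              ∃ Q : (W.baseChange (ringClassField K ι n)).toAffine.Point, ((2 ^ m : ℕ) : ℤ) • Q = d.derivedPoint) →
          ∀ (n : ℕ) (d : KolyvaginHeegnerData Dt β ι n), Squarefree n →
            (∀ ℓ ∈ n.primeFactors, Zhang2014.IsKolyvaginPrime (W.conductorNorm ℤ) W K 2 ℓ) →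
            ((sigmaShift W Dt + 1 : ℕ) : ℕ∞) ≤ Zhang2014.levelIndex W 2 n →
            (¬ ∃ Q : (W.baseChange (ringClassField K ι n)).toAffine.Point,
              ((2 ^ (sigmaShift W Dt + 1) : ℕ) : ℤ) • Q = d.derivedPoint) →
            Nat.card (AddCommGroup.primaryComponent (W.baseChange K).sha 2) = 2 ^ (2 * (M₀ - sigmaShift W Dt))

/-- **REGULAR type at `2`** (a witness FILTER, elementary Legendre form): `Δ_W` (numerator × denominator) is a non-square modulo `ℓ`.  For a
Kolyvagin prime at `2` (`a_ℓ` even, `ℓ ∤ 2Δ`) this says `ρ̄_{W,2}(Frob_ℓ)` is a TRANSPOSITION of `E[2] ∖ 0`, so `E[2^M] ≅ ℤ/2^M[Frob_ℓ]` is free of rank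
one (`OffBigImageOddLocalAtTwo.cyclicTorsion_of_smul_twoTorsion_ne`) and the local Kummer map at `ℓ` loses no bit (`localKummerLossless`); card
`regular-frobenius-kolyvagin-primes-pos-disc`. -/
def RegularAtTwo (W : WeierstrassCurve ℚ) (ℓ : ℕ) : Prop :=
  ¬ IsSquare (((W.Δ.num * (W.Δ.den : ℤ) : ℤ) : ZMod ℓ))

/-- **SHARP at `2`** (card `sharp-kolyvagin-primes-at-two`, level-free form): `2^{M(ℓ)+1} ∣ ℓ + 1` with `M(ℓ) = min(v₂(ℓ+1), v₂(a_ℓ))` Zhang's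
Kolyvagin index, i.e. `v₂(a_ℓ) = M(ℓ)` exactly (`a_ℓ = 0` is never sharp).  Stated under the `IsGloballyMinimal` instance binder because
`Zhang2014.kolyvaginIndex` reads `a_ℓ` off the minimal model. (WZhang2014, Notations (xii)) -/
def SharpAtTwo (W : WeierstrassCurve ℚ) (ℓ : ℕ) : Prop :=
  ∀ [W.IsGloballyMinimal], 2 ^ (Zhang2014.kolyvaginIndex W 2 ℓ + 1) ∣ ℓ + 1

/-- **SHARP-REGULAR** (card `sharp-kolyvagin-primes-at-two` = RESERVE #4, routed to this line as the sharp refinement of the regular filter;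
`sharpRegular_le_regular`). -/
def SharpRegularAtTwo (W : WeierstrassCurve ℚ) (ℓ : ℕ) : Prop :=
  SharpAtTwo W ℓ ∧ RegularAtTwo W ℓ

/-- **Cell γ₂c** of the S₃-locus: `2Δ ∈ ℚ^{×2}` (`ℚ(E[2]) ⊃ ℚ(√2)`, `Δ > 0`, `2`-adic image `⊂ H₈`; Dokchitser–Dokchitser (3) / RZB).  The cell on
which type filters run out of primes above level `2`; served with `Φ = ⊤`. (DokchitserDokchitserMathZ2012, Theorem (3)) -/
def OnGamma2c (W : WeierstrassCurve ℚ) : Prop :=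
  IsSquare (2 * W.Δ)

/-- **The complement of γ₂c** inside the S₃-locus (δ⁺ ∪ δ⁻ ∪ γ₂a ∪ γ₂b ∪ γ₂d once `ρ̄_{W,2}` is onto): regular primes of every level, sharp-regular
of every level `≥ 2` (anatomy §4). -/
def OffGamma2c (W : WeierstrassCurve ℚ) : Prop :=
  ¬ IsSquare (2 * W.Δ)

/-- **Cell δ⁺**: `Δ > 0` and full `2`-adic image (`ρ_{W,2^n}` onto for all `n`) — the cell the regular filter is designed for (complex conjugation
is diagonal modulo every `2^M` there and loses the top bit; a regular Frobenius does not). -/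
def OnDeltaPlus (W : WeierstrassCurve ℚ) [W.IsElliptic] : Prop :=
  0 < W.Δ ∧ ∀ n : ℕ, W.HasSurjectiveModNGaloisRep ((2 ^ n : ℕ) : ℤ)

/-- **S4″(Φ, Ω) `StringentPrimitivityModTwoWithOn Φ Ω` — K2 with witness filter `Φ` ON THE CELL `Ω`:** `StringentPrimitivityModTwoWith Φ` with
one more binder `Ω W` after the habitat binder.  `Ω = ⊤` recovers the cell-free statement; monotone in both slots (finer filter / larger cell ⇒
stronger).  The shape in which the filtered programme (cards #7/#8) is typed: `Ω` avoiding γ₂c. -/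
def StringentPrimitivityModTwoWithOn (Φ : WeierstrassCurve ℚ → ℕ → Prop) (Ω : WeierstrassCurve ℚ → Prop) : Prop :=
  ∀ (W : WeierstrassCurve ℚ) [W.IsElliptic] [W.IsGloballyMinimal] [NeZero (W.conductorNorm ℤ)],
    ¬ W.HasCM → W.HasSurjectiveModNGaloisRep 2 → Ω W → W.analyticRank = 1 →
    ∀ (K : Type) [Field K] [NumberField K], IsImaginaryQuadratic K → Odd (NumberField.discr K) →
      NumberField.discr K ≠ -3 → SatisfiesHeegnerHypothesis (W.conductorNorm ℤ) K →
      ¬ IsSquare ((NumberField.discr K : ℚ) * -|W.Δ|) → ¬ IsSquare ((NumberField.discr K : ℚ) * (-(2 * |W.Δ|))) →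
      ∀ (Dt : ModularParametrizationData W (W.conductorNorm ℤ)) (β : ℤ) (ι : K →+* ℂ) (d₁ : KolyvaginHeegnerData Dt β ι 1),
        ¬ IsOfFinAddOrder d₁.derivedPoint →
        ∃ (n : ℕ) (d : KolyvaginHeegnerData Dt β ι n), Squarefree n ∧
          (∀ ℓ ∈ n.primeFactors, Zhang2014.IsKolyvaginPrime (W.conductorNorm ℤ) W K 2 ℓ ∧ Φ W ℓ) ∧
          ((sigmaShift W Dt + 1 : ℕ) : ℕ∞) ≤ Zhang2014.levelIndex W 2 n ∧
          ¬ ∃ Q : (W.baseChange (ringClassField K ι n)).toAffine.Point,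
            ((2 ^ (sigmaShift W Dt + 1) : ℕ) : ℤ) • Q = d.derivedPoint

/-- **S5″(Φ, Ω) `ShiftedKolyvaginStructureModTwoWithOn Φ Ω` — K3 with witness filter `Φ` ON THE CELL `Ω`:** `ShiftedKolyvaginStructureModTwoWith Φ`
with the binder `Ω W` added; antitone in both slots (finer filter / smaller cell ⇒ weaker). (McCallumLMS1991, §5) -/
def ShiftedKolyvaginStructureModTwoWithOn (Φ : WeierstrassCurve ℚ → ℕ → Prop) (Ω : WeierstrassCurve ℚ → Prop) : Prop :=
  ∀ (W : WeierstrassCurve ℚ) [W.IsElliptic] [W.IsGloballyMinimal] [NeZero (W.conductorNorm ℤ)],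
    ¬ W.HasCM → W.HasSurjectiveModNGaloisRep 2 → Ω W →
    ∀ (K : Type) [Field K] [NumberField K], IsImaginaryQuadratic K → Odd (NumberField.discr K) →
      NumberField.discr K ≠ -3 → SatisfiesHeegnerHypothesis (W.conductorNorm ℤ) K →
      ¬ IsSquare ((NumberField.discr K : ℚ) * -|W.Δ|) → ¬ IsSquare ((NumberField.discr K : ℚ) * (-(2 * |W.Δ|))) →
      ∀ (Dt : ModularParametrizationData W (W.conductorNorm ℤ)) (β : ℤ) (ι : K →+* ℂ) (d₁ : KolyvaginHeegnerData Dt β ι 1),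
        ¬ IsOfFinAddOrder d₁.derivedPoint →
        ∀ (M₀ : ℕ), (∃ Q : (W.baseChange (ringClassField K ι 1)).toAffine.Point, ((2 ^ M₀ : ℕ) : ℤ) • Q = d₁.derivedPoint) →
          (¬ ∃ Q : (W.baseChange (ringClassField K ι 1)).toAffine.Point, ((2 ^ (M₀ + 1) : ℕ) : ℤ) • Q = d₁.derivedPoint) →
          (∀ (n : ℕ) (d : KolyvaginHeegnerData Dt β ι n) (m : ℕ), Squarefree n →
              (∀ ℓ ∈ n.primeFactors, Zhang2014.IsKolyvaginPrime (W.conductorNorm ℤ) W K 2 ℓ) →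
              (m : ℕ∞) ≤ Zhang2014.levelIndex W 2 n → m ≤ sigmaShift W Dt →
              ∃ Q : (W.baseChange (ringClassField K ι n)).toAffine.Point, ((2 ^ m : ℕ) : ℤ) • Q = d.derivedPoint) →
          ∀ (n : ℕ) (d : KolyvaginHeegnerData Dt β ι n), Squarefree n →
            (∀ ℓ ∈ n.primeFactors, Zhang2014.IsKolyvaginPrime (W.conductorNorm ℤ) W K 2 ℓ ∧ Φ W ℓ) →
            ((sigmaShift W Dt + 1 : ℕ) : ℕ∞) ≤ Zhang2014.levelIndex W 2 n →
            (¬ ∃ Q : (W.baseChange (ringClassField K ι n)).toAffine.Point,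
              ((2 ^ (sigmaShift W Dt + 1) : ℕ) : ℤ) • Q = d.derivedPoint) →
            Nat.card (AddCommGroup.primaryComponent (W.baseChange K).sha 2) = 2 ^ (2 * (M₀ - sigmaShift W Dt))

/-- **Cell `Δ < 0`** of the S₃-locus (= δ⁻ ∪ γ₂a ∪ γ₂b ∪ γ₂d once `ρ̄_{W,2}` is onto: `gamma2abd_of_neg_of_not_full`): complex conjugation is a
transposition on `E[2]` and `E[2^M]` is `ℤ/2^M[c₀]`-free of rank one (Q1 `CyclicTorsionOfNegDisc`, PROVED in the tree) — full supply for the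
numerical (`Φ = ⊤`) and for the regular filter alike. -/
def OnDeltaMinus (W : WeierstrassCurve ℚ) : Prop :=
  W.Δ < 0

/-- **Cell δ⁺, plain-typed** (the `Ω`-slot form of `OnDeltaPlus`: the instance binder is inside, so the cell has type `WeierstrassCurve ℚ → Prop`;
`onDeltaPlusCell_iff`). -/
def OnDeltaPlusCell (W : WeierstrassCurve ℚ) : Prop :=
  0 < W.Δ ∧ ∀ [W.IsElliptic] (n : ℕ), W.HasSurjectiveModNGaloisRep ((2 ^ n : ℕ) : ℤ)

/-- **Sub-cell γ₂a**: `−Δ ∈ ℚ^{×2}` (`ℚ(E[2]) ⊃ ℚ(i)`, `2`-adic image `⊂ H₋₄`; the quadratic resolvent of the `2`-division cubic is `K₀ = ℚ(i)` —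
card #9's face). (DokchitserDokchitserMathZ2012, Theorem (2)) -/
def OnGamma2a (W : WeierstrassCurve ℚ) : Prop :=
  IsSquare (-W.Δ)

/-- **Sub-cell γ₂b**: `j = −4t³(t + 8)` (the `X_ns⁺(4)` family; on the S₃-locus it has `Δ < 0`: `delta_neg_of_gamma2b`).
(DokchitserDokchitserMathZ2012, Theorem (2)) -/
def OnGamma2b (W : WeierstrassCurve ℚ) [W.IsElliptic] : Prop :=
  ∃ t : ℚ, W.j = -4 * t ^ 3 * (t + 8)

/-- **Sub-cell γ₂d**: `−2Δ ∈ ℚ^{×2}` (image `⊂ H₋₈`, resolvent `ℚ(√−2)`).  By TRIAGE-r4-2 F1 every globally minimal γ₂d curve is BAD at `2`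
(`v₂(Δ_min)` odd): the `2 ∣ N` ledger, no printed E-side formula — served K-side only. (DokchitserDokchitserMathZ2012, Theorem (3)) -/
def OnGamma2d (W : WeierstrassCurve ℚ) : Prop :=
  IsSquare (-2 * W.Δ)

/-- **E-SIDE CHART SOCKET on a cell `Ω` of the S₃-locus**: an instrument delivering `BSD₂(W)` outright for every globally minimal non-CM `W`
with `ρ̄_{W,2}` onto, `Ω W` and analytic rank `1`, GIVEN rank-`0` `BSD₂` of non-CM globally minimal curves by name (`RankOneAtTwoOneDoor.S_rankZeroTwin`)
for its twin.  Any instrument whose per-curve conclusion is `BSD₂(W)` (card #9's resolvent door, card #10's Jacquet–Langlands transfer) fills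
such a socket and takes its cell OUT of the Kolyvagin stubs' habitat in the line's atlas glue. -/
def EChartAtTwo (Ω : WeierstrassCurve ℚ → Prop) : Prop :=
  S_rankZeroTwin → ∀ (W : WeierstrassCurve ℚ) [W.IsElliptic] [W.IsGloballyMinimal], ¬ W.HasCM → W.HasSurjectiveModNGaloisRep 2 → Ω W →
    W.analyticRank = 1 → BSDp W 2

end Summit.BirchSwinnertonDyer.BirchSwinnertonDyer.Theorems.OffBigImageOddLocalAtTwo

end
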